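import Literature.AlgebraicGeometry.Motives.HypersurfaceFormsIrreducible
import Mathlib.Algebra.MvPolynomial.Equiv
import Mathlib.Algebra.MvPolynomial.PDeriv
import Mathlib.Algebra.Polynomial.Div
import Mathlib.Algebra.Polynomial.Degree.SmallDegree
import Mathlib.RingTheory.Ideal.Quotient.Operations
import Mathlib.RingTheory.Polynomial.Basic
import Mathlib.RingTheory.Polynomial.UniqueFactorization
import Mathlib.Algebra.GroupWithZero.NonZeroDivisors
import Mathlib.Tactic.ComputeDegree
import Mathlib.Tactic.LinearCombination
import HarnessLib

/-!
# F4POS-1 (c), CORE: the CI chart `D(y)` of `Bl_τ(P2d4C)` — `C = k[x,y,w,u′,t′,z′]/(x² − wy, z′² + y(1 + w²z′ + u′³ + t′³))`: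
# normal form modulo the monic quadratic, and `x̄` is a non-zero-divisor
# (crux `FInjectiveMacaulayfication` stmt-ResolutionOfSingularities-15315, chain w45a; res-L1-w45a-plan-1 RULINGS R18.4 (2) / R18.10 «F4POS-1 (c) = the CI charts
# D(y), D(u), D(t) of floor 1 of the τ-tower»; seat res-L1-w45a-stub-1 g10)

[OURS · L1 W4.5a] Support file (`--supports stmt-ResolutionOfSingularities-15315 --as helper`); def-free, unconditional, ANY field `k`; replaces the
role of NO printed item; NOT a statement of the manuscript; AI-written (AI review is weaker than expert review).

SETTING. `X = V(z² + x⁴z + y³ + u³ + t³) ⊂ 𝔸⁵`, `τ = (x², y, u, t, z)`; on the Rees chart `D(y)` of `Bl_τ X` put `w = x²/y`, `u′ = u/y`, `t′ = t/y`, `z′ = z/y`: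
`f = y²·(z′² + y(1 + w²z′ + u′³ + t′³))` (`x⁴z = w²y³z′`), so the chart ring is the complete intersection
`C = k[X₀..X₅]/(g₁, g₂)`, `X 0 = x, X 1 = y, X 2 = w, X 3 = u′, X 4 = t′, X 5 = z′`, `g₁ = X₀² − X₂X₁`, `g₂ = X₅² + X₁(1 + X₂²X₅ + X₃³ + X₄³)`
(the charts `D(u)`, `D(t)` are the same ring under `y ↔ u ↔ t`). This file (structure only; the scheme-level identification with the chart is NOT claimed):
* §1 `prime_g₁'` — `x² − wy` is prime in `k[X₀..X₄]` (as `T² − wy` over `k[y,w,u′,t′]`: `irreducible_X_pow_add_C_mul_X_add_C` at `y = 1, w = 0`);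
  `X_zero_not_dvd` (`g₁ ∤ x`: evaluate at `(1,1,1,0,0)`).
* §2 the coordinate change `k[X₀..X₅] ≃ₐ k[X₀..X₄][T]` (`X 5 ↦ T`) and the images `C r`, `C g₁'`, `T² + C(yw²)T + C(y(1+u′³+t′³))` of `rename castSucc r`, `g₁`, `g₂`.
* §3 NORMAL FORM modulo the monic quadratic `g₂`: `exists_normalForm` (every class is `r̄ + s̄·z̄′`, `r,s ∈ k[X₀..X₄]`), ★ `dvd_of_normalForm_eq_zero`
  (`r̄ + s̄ z̄′ = 0 ⇒ g₁' ∣ r ∧ g₁' ∣ s`, by `modByMonic`), `sq_z_eq`.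
* §4 ★ `mk_X_zero_mem_nonZeroDivisors` — **`x̄` is a non-zero-divisor of `C`** (the CI substitute for «`x` prime, `x ∤ f′`» of the hypersurface chart
  `TauFloorOneNotFull.mk_X0_mem_nonZeroDivisors`); used for `height (x̄, ȳ, z̄′) = 1` in `…TauFloorOneCIChartNotFull`.
[folklore commutative algebra, OURS as a certificate]
-/

-- single-problem summit: the doubled namespace component is forced
set_option linter.dupNamespace false

noncomputable section

namespace Summit.ResolutionOfSingularities.ResolutionOfSingularities.Theorems.FInjectiveMacaulayfication.TauFloorOneCIChartCore

open MvPolynomial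

variable (k : Type) [Field k]

/-! ## §1 `g₁' = x² − wy` is prime in `k[x,y,w,u′,t′]`, and does not divide `x` -/

/-- **`x² − wy` is prime in `k[X₀..X₄]`**: under `k[X₀..X₄] ≃ k[X₁..X₄][T]` (`X 0 ↦ T`) it is `T² + 0·T + C(−X₂X₁)`… in the target's own names
`T² + C 0 · T + C (−X 1 · X 0)`, and `−wy` vanishes at the point `(y, w, u′, t′) = (1, 0, 0, 0)` where `∂_w(−wy) = −y = −1 ≠ 0`. [folklore] -/
theorem prime_g₁' (g : MvPolynomial (Fin 5) k) (hg : g = X 0 ^ 2 - X 2 * X 1) : Prime g := by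
  set e : MvPolynomial (Fin 5) k ≃+* Polynomial (MvPolynomial (Fin 4) k) := (finSuccEquiv k 4).toRingEquiv with he_def
  have he0 : e (X 0) = Polynomial.X := finSuccEquiv_X_zero
  have hej : ∀ j : Fin 4, e (X j.succ) = Polynomial.C (X j) := fun j => finSuccEquiv_X_succ (j := j)
  set c : MvPolynomial (Fin 4) k := -(X 1 * X 0) with hc
  have heg : e g = Polynomial.X ^ 2 + Polynomial.C (0 : MvPolynomial (Fin 4) k) * Polynomial.X + Polynomial.C c := by
    rw [hg, map_sub, map_pow, map_mul, he0, show (2 : Fin 5) = (1 : Fin 4).succ from rfl, show (1 : Fin 5) = (0 : Fin 4).succ from rfl,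
      hej, hej, hc]
    simp only [map_zero, zero_mul, add_zero, map_neg, map_mul]
    ring
  set a : Fin 4 → k := ![1, 0, 0, 0] with ha
  have hba : MvPolynomial.eval a (0 : MvPolynomial (Fin 4) k) = 0 := map_zero _
  have hca : MvPolynomial.eval a c = 0 := by rw [hc]; simp [ha]
  have hder : MvPolynomial.eval a (pderiv 1 c) ≠ 0 := by
    have e1 : pderiv 1 c = -X 0 := by
      rw [hc, map_neg, (pderiv 1).leibniz, pderiv_X_self, pderiv_X_of_ne (show (0 : Fin 4) ≠ 1 by decide)]
      simp
    rw [e1, map_neg, eval_X, ha]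
    simp
  have hirr : Irreducible (e g) := by
    rw [heg]
    exact Literature.AlgebraicGeometry.Motives.SmoothHypersurface.irreducible_X_pow_add_C_mul_X_add_C (d := 2) le_rfl 0 c a hba hca 1 hder
  exact (MulEquiv.prime_iff e).mp hirr.prime

/-- `g₁' = x² − wy` does not divide `x` (evaluate at `(x,y,w) = (1,1,1)`). [folklore] -/
theorem not_dvd_X_zero (g : MvPolynomial (Fin 5) k) (hg : g = X 0 ^ 2 - X 2 * X 1) : ¬ g ∣ X 0 := by
  rintro ⟨q, hq⟩
  have h := congrArg (MvPolynomial.eval (![1, 1, 1, 0, 0] : Fin 5 → k)) hq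
  rw [map_mul, hg] at h
  simp at h

/-! ## §2 The coordinate change `k[X₀..X₅] ≃ₐ k[X₀..X₄][T]`, `X 5 ↦ T` -/

/-- The coordinate change singling out `z′ = X 5`. [plumbing] -/
theorem exists_algEquiv_polynomial :
    ∃ e : MvPolynomial (Fin 6) k ≃ₐ[k] Polynomial (MvPolynomial (Fin 5) k),
      e (X 5) = Polynomial.X ∧ ∀ j : Fin 5, e (X (Fin.castSucc j)) = Polynomial.C (X j) := by
  refine ⟨(renameEquiv k (_root_.finRotate 6)).trans (finSuccEquiv k 5), ?_, fun j => ?_⟩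
  · rw [AlgEquiv.trans_apply, renameEquiv_apply, rename_X, show (_root_.finRotate 6) (5 : Fin 6) = 0 by decide, finSuccEquiv_X_zero]
  · have hrot : ∀ j : Fin 5, (_root_.finRotate 6) (Fin.castSucc j) = j.succ := by decide
    rw [AlgEquiv.trans_apply, renameEquiv_apply, rename_X, hrot j, finSuccEquiv_X_succ]

/-- Such a coordinate change sends `rename castSucc r` to the constant `C r`. [plumbing] -/
theorem algEquiv_rename_castSucc (e : MvPolynomial (Fin 6) k ≃ₐ[k] Polynomial (MvPolynomial (Fin 5) k))
    (hej : ∀ j : Fin 5, e (X (Fin.castSucc j)) = Polynomial.C (X j)) (r : MvPolynomial (Fin 5) k) :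
    e (rename Fin.castSucc r) = Polynomial.C r := by
  induction r using MvPolynomial.induction_on with
  | C a =>
    rw [rename_C]
    exact (e.commutes a).trans (by rw [Polynomial.algebraMap_apply]; rfl)
  | add p q hp hq => rw [map_add, map_add, hp, hq, Polynomial.C_add]
  | mul_X p j hp => rw [map_mul, map_mul, hp, rename_X, hej, ← Polynomial.C_mul]

/-- … `g₁ = x² − wy` to the constant `C g₁'` … [plumbing] -/
theorem algEquiv_g₁ (e : MvPolynomial (Fin 6) k ≃ₐ[k] Polynomial (MvPolynomial (Fin 5) k))
    (hej : ∀ j : Fin 5, e (X (Fin.castSucc j)) = Polynomial.C (X j)) (g₁ : MvPolynomial (Fin 6) k) (hg₁ : g₁ = X 0 ^ 2 - X 2 * X 1) :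
    e g₁ = Polynomial.C (X 0 ^ 2 - X 2 * X 1) := by
  have : g₁ = rename Fin.castSucc (X 0 ^ 2 - X 2 * X 1 : MvPolynomial (Fin 5) k) := by
    rw [hg₁]; simp only [map_sub, map_pow, map_mul, rename_X]; rfl
  rw [this, algEquiv_rename_castSucc k e hej]

/-- … and `g₂` to the monic quadratic `T² + C(X₁X₂²)·T + C(X₁(1 + X₃³ + X₄³))`. [plumbing] -/
theorem algEquiv_g₂ (e : MvPolynomial (Fin 6) k ≃ₐ[k] Polynomial (MvPolynomial (Fin 5) k)) (he5 : e (X 5) = Polynomial.X)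
    (hej : ∀ j : Fin 5, e (X (Fin.castSucc j)) = Polynomial.C (X j)) (g₂ : MvPolynomial (Fin 6) k)
    (hg₂ : g₂ = X 5 ^ 2 + X 1 * (1 + X 2 ^ 2 * X 5 + X 3 ^ 3 + X 4 ^ 3)) :
    e g₂ = Polynomial.X ^ 2 + Polynomial.C (X 1 * X 2 ^ 2) * Polynomial.X + Polynomial.C (X 1 * (1 + X 3 ^ 3 + X 4 ^ 3)) := by
  rw [hg₂, map_add, map_pow, he5, map_mul, map_add, map_add, map_add, map_one, map_mul, map_pow, he5, map_pow, map_pow,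
    show (1 : Fin 6) = Fin.castSucc (1 : Fin 5) from rfl, show (2 : Fin 6) = Fin.castSucc (2 : Fin 5) from rfl,
    show (3 : Fin 6) = Fin.castSucc (3 : Fin 5) from rfl, show (4 : Fin 6) = Fin.castSucc (4 : Fin 5) from rfl, hej, hej, hej, hej]
  simp only [map_add, map_mul, map_pow, map_one]
  ring

/-! ## §3 Normal form modulo the monic quadratic -/

/-- The relation in `C` (any field): `z̄′² = −ȳ·(1 + w̄²z̄′ + ū′³ + t̄′³)`. [plumbing] -/
theorem sq_z_eq (g₁ g₂ : MvPolynomial (Fin 6) k) (hg₂ : g₂ = X 5 ^ 2 + X 1 * (1 + X 2 ^ 2 * X 5 + X 3 ^ 3 + X 4 ^ 3)) :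
    Ideal.Quotient.mk (Ideal.span {g₁, g₂}) (X 5) ^ 2 =
      -(Ideal.Quotient.mk (Ideal.span {g₁, g₂}) (X 1) * (1 + Ideal.Quotient.mk (Ideal.span {g₁, g₂}) (X 2) ^ 2 *
        Ideal.Quotient.mk (Ideal.span {g₁, g₂}) (X 5) + Ideal.Quotient.mk (Ideal.span {g₁, g₂}) (X 3) ^ 3 +
          Ideal.Quotient.mk (Ideal.span {g₁, g₂}) (X 4) ^ 3)) := by
  have hrel : Ideal.Quotient.mk (Ideal.span {g₁, g₂}) (X 5 ^ 2 + X 1 * (1 + X 2 ^ 2 * X 5 + X 3 ^ 3 + X 4 ^ 3)) = 0 := by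
    rw [← hg₂]
    exact Ideal.Quotient.eq_zero_iff_mem.mpr (Ideal.subset_span (Or.inr rfl))
  simp only [map_add, map_mul, map_pow, map_one] at hrel
  linear_combination hrel

/-- ★ **Existence of the normal form**: every element of `C` is `r̄ + s̄·z̄′` with `r, s ∈ k[X₀..X₄]`. [folklore] -/
theorem exists_normalForm (g₁ g₂ : MvPolynomial (Fin 6) k) (hg₂ : g₂ = X 5 ^ 2 + X 1 * (1 + X 2 ^ 2 * X 5 + X 3 ^ 3 + X 4 ^ 3))
    (x : MvPolynomial (Fin 6) k ⧸ Ideal.span {g₁, g₂}) :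
    ∃ r s : MvPolynomial (Fin 5) k, x = Ideal.Quotient.mk (Ideal.span {g₁, g₂}) (rename Fin.castSucc r) +
      Ideal.Quotient.mk (Ideal.span {g₁, g₂}) (rename Fin.castSucc s) * Ideal.Quotient.mk (Ideal.span {g₁, g₂}) (X 5) := by
  obtain ⟨q, rfl⟩ := Ideal.Quotient.mk_surjective x
  induction q using MvPolynomial.induction_on with
  | C a => exact ⟨C a, 0, by rw [rename_C, map_zero, map_zero, zero_mul, add_zero]⟩
  | add p q hp hq =>
    obtain ⟨⟨r₁, s₁, h₁⟩, ⟨r₂, s₂, h₂⟩⟩ := And.intro hp hq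
    exact ⟨r₁ + r₂, s₁ + s₂, by rw [map_add, h₁, h₂]; simp only [map_add]; ring⟩
  | mul_X p i hp =>
    obtain ⟨⟨r, s, h⟩, ⟨j, rfl⟩ | rfl⟩ := And.intro hp (Fin.eq_castSucc_or_eq_last i)
    · exact ⟨r * X j, s * X j, by rw [map_mul, h]; simp only [map_mul, rename_X]; ring⟩
    · refine ⟨-(s * (X 1 * (1 + X 3 ^ 3 + X 4 ^ 3))), r - s * (X 1 * X 2 ^ 2), ?_⟩
      have hz := sq_z_eq k g₁ g₂ hg₂
      have c1 : (Fin.castSucc (1 : Fin 5) : Fin 6) = 1 := rfl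
      have c2 : (Fin.castSucc (2 : Fin 5) : Fin 6) = 2 := rfl
      have c3 : (Fin.castSucc (3 : Fin 5) : Fin 6) = 3 := rfl
      have c4 : (Fin.castSucc (4 : Fin 5) : Fin 6) = 4 := rfl
      rw [map_mul, h, show X (Fin.last 5) = (X 5 : MvPolynomial (Fin 6) k) from rfl]
      simp only [map_mul, map_add, map_sub, map_neg, map_pow, map_one, rename_X, c1, c2, c3, c4]
      linear_combination Ideal.Quotient.mk (Ideal.span {g₁, g₂}) (rename Fin.castSucc s) * hz

/-- ★ **The normal form detects `(g₁)`**: `r̄ + s̄·z̄′ = 0` in `C` forces `g₁' ∣ r` and `g₁' ∣ s` (`g₁' = x² − wy` in `k[X₀..X₄]`): apply the coordinate change,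
reduce modulo the monic quadratic (`modByMonic`), compare coefficients. Any field `k`. [folklore] -/
theorem dvd_of_normalForm_eq_zero (g₁ g₂ : MvPolynomial (Fin 6) k) (hg₁ : g₁ = X 0 ^ 2 - X 2 * X 1)
    (hg₂ : g₂ = X 5 ^ 2 + X 1 * (1 + X 2 ^ 2 * X 5 + X 3 ^ 3 + X 4 ^ 3)) (r s : MvPolynomial (Fin 5) k)
    (h : Ideal.Quotient.mk (Ideal.span {g₁, g₂}) (rename Fin.castSucc r) +
      Ideal.Quotient.mk (Ideal.span {g₁, g₂}) (rename Fin.castSucc s) * Ideal.Quotient.mk (Ideal.span {g₁, g₂}) (X 5) = 0) :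
    (X 0 ^ 2 - X 2 * X 1 : MvPolynomial (Fin 5) k) ∣ r ∧ (X 0 ^ 2 - X 2 * X 1 : MvPolynomial (Fin 5) k) ∣ s := by
  obtain ⟨e, he5, hej⟩ := exists_algEquiv_polynomial k
  have hmem : rename Fin.castSucc r + rename Fin.castSucc s * X 5 ∈ Ideal.span {g₁, g₂} := by
    rw [← Ideal.Quotient.eq_zero_iff_mem]; simpa only [map_add, map_mul] using h
  obtain ⟨A, B, hAB⟩ := Ideal.mem_span_pair.mp hmem
  -- push through the coordinate change
  set G : Polynomial (MvPolynomial (Fin 5) k) :=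
    Polynomial.X ^ 2 + Polynomial.C (X 1 * X 2 ^ 2) * Polynomial.X + Polynomial.C (X 1 * (1 + X 3 ^ 3 + X 4 ^ 3)) with hG
  set g : MvPolynomial (Fin 5) k := X 0 ^ 2 - X 2 * X 1 with hgdef
  have hmonic : G.Monic := by rw [hG]; monicity!
  have hdegG : G.degree = 2 := by rw [hG]; compute_degree!
  have hE : Polynomial.C s * Polynomial.X + Polynomial.C r = Polynomial.C g * e A + e B * G := by
    have := congrArg e hAB
    rw [map_add, map_mul e A g₁, map_mul e B g₂, algEquiv_g₁ k e hej g₁ hg₁, algEquiv_g₂ k e he5 hej g₂ hg₂, map_add,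
      map_mul e (rename Fin.castSucc s) (X 5), algEquiv_rename_castSucc k e hej, algEquiv_rename_castSucc k e hej, he5] at this
    rw [← hgdef, ← hG] at this
    linear_combination (-1 : Polynomial (MvPolynomial (Fin 5) k)) * this
  -- reduce modulo the monic quadratic
  have hmod : Polynomial.C s * Polynomial.X + Polynomial.C r = Polynomial.C g * (e A %ₘ G) := by
    have h1 : (Polynomial.C s * Polynomial.X + Polynomial.C r) %ₘ G = Polynomial.C s * Polynomial.X + Polynomial.C r :=
      (Polynomial.modByMonic_eq_self_iff hmonic).mpr (by rw [hdegG]; exact Polynomial.degree_linear_lt)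
    have h2 : (Polynomial.C g * e A + e B * G) %ₘ G = Polynomial.C g * (e A %ₘ G) := by
      rw [Polynomial.add_modByMonic, (Polynomial.modByMonic_eq_zero_iff_dvd hmonic).mpr (dvd_mul_left G (e B)), add_zero,
        Polynomial.C_mul', Polynomial.smul_modByMonic, ← Polynomial.C_mul']
    rw [← h1, hE, h2]
  -- the reduced cofactor is linear
  have hdegA : (e A %ₘ G).degree ≤ 1 := by
    have := Polynomial.degree_modByMonic_lt (e A) hmonic
    rw [hdegG] at this
    exact Order.le_of_lt_succ (by exact_mod_cast this)
  rw [Polynomial.eq_X_add_C_of_degree_le_one hdegA, mul_add, ← mul_assoc, ← Polynomial.C_mul, ← Polynomial.C_mul] at hmod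
  have h0 := congrArg (Polynomial.coeff · 0) hmod
  have h1 := congrArg (Polynomial.coeff · 1) hmod
  simp only [Polynomial.coeff_add, Polynomial.coeff_C_mul, Polynomial.coeff_X_zero, Polynomial.coeff_C_zero, mul_zero, zero_add,
    Polynomial.coeff_X_one, mul_one, Polynomial.coeff_C_succ, add_zero] at h0 h1
  exact ⟨⟨_, h0⟩, ⟨_, h1⟩⟩

/-- Conversely `g₁' ∣ r ⇒ r̄ = 0` in `C`. [plumbing] -/
theorem mk_rename_eq_zero_of_dvd (g₁ g₂ : MvPolynomial (Fin 6) k) (hg₁ : g₁ = X 0 ^ 2 - X 2 * X 1) (r : MvPolynomial (Fin 5) k)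
    (hr : (X 0 ^ 2 - X 2 * X 1 : MvPolynomial (Fin 5) k) ∣ r) : Ideal.Quotient.mk (Ideal.span {g₁, g₂}) (rename Fin.castSucc r) = 0 := by
  obtain ⟨q, rfl⟩ := hr
  rw [map_mul, map_mul]
  have : rename Fin.castSucc (X 0 ^ 2 - X 2 * X 1 : MvPolynomial (Fin 5) k) = g₁ := by
    rw [hg₁]; simp only [map_sub, map_pow, map_mul, rename_X]; rfl
  rw [this, Ideal.Quotient.eq_zero_iff_mem.mpr (Ideal.subset_span (Or.inl rfl) : g₁ ∈ Ideal.span {g₁, g₂}), zero_mul]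

/-! ## §4 `x̄` is a non-zero-divisor of `C` -/

/-- ★ **`x̄ = X̄₀` is a non-zero-divisor of `C = k[X₀..X₅]/(g₁, g₂)`** (any field `k`): if `c·x̄ = 0`, write `c = r̄ + s̄ z̄′`; then `g₁' ∣ x·r` and `g₁' ∣ x·s`, and
`g₁'` is prime with `g₁' ∤ x`, so `g₁' ∣ r, s`, i.e. `c = 0`. [folklore] -/
theorem mk_X_zero_mem_nonZeroDivisors (g₁ g₂ : MvPolynomial (Fin 6) k) (hg₁ : g₁ = X 0 ^ 2 - X 2 * X 1)
    (hg₂ : g₂ = X 5 ^ 2 + X 1 * (1 + X 2 ^ 2 * X 5 + X 3 ^ 3 + X 4 ^ 3)) :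
    Ideal.Quotient.mk (Ideal.span {g₁, g₂}) (X 0) ∈ nonZeroDivisors (MvPolynomial (Fin 6) k ⧸ Ideal.span {g₁, g₂}) := by
  have hp := prime_g₁' k _ rfl
  refine mem_nonZeroDivisors_iff_right.mpr fun c hc => ?_
  obtain ⟨r, s, rfl⟩ := exists_normalForm k g₁ g₂ hg₂ c
  have h0 : Ideal.Quotient.mk (Ideal.span {g₁, g₂}) (rename Fin.castSucc (r * X 0)) +
      Ideal.Quotient.mk (Ideal.span {g₁, g₂}) (rename Fin.castSucc (s * X 0)) * Ideal.Quotient.mk (Ideal.span {g₁, g₂}) (X 5) = 0 := by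
    have c0 : (Fin.castSucc (0 : Fin 5) : Fin 6) = 0 := rfl
    rw [← hc]; simp only [map_mul, rename_X, c0]; ring
  obtain ⟨hr, hs⟩ := dvd_of_normalForm_eq_zero k g₁ g₂ hg₁ hg₂ _ _ h0
  have hr' := (hp.dvd_or_dvd hr).resolve_right (not_dvd_X_zero k _ rfl)
  have hs' := (hp.dvd_or_dvd hs).resolve_right (not_dvd_X_zero k _ rfl)
  rw [mk_rename_eq_zero_of_dvd k g₁ g₂ hg₁ r hr', mk_rename_eq_zero_of_dvd k g₁ g₂ hg₁ s hs', zero_mul, add_zero]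

/-- `w̄·ȳ = x̄²` in `C`. [plumbing] -/
theorem mk_X_two_mul_X_one (g₁ g₂ : MvPolynomial (Fin 6) k) (hg₁ : g₁ = X 0 ^ 2 - X 2 * X 1) :
    Ideal.Quotient.mk (Ideal.span {g₁, g₂}) (X 2) * Ideal.Quotient.mk (Ideal.span {g₁, g₂}) (X 1) =
      Ideal.Quotient.mk (Ideal.span {g₁, g₂}) (X 0) ^ 2 := by
  have hrel : Ideal.Quotient.mk (Ideal.span {g₁, g₂}) (X 0 ^ 2 - X 2 * X 1) = 0 := by
    rw [← hg₁]
    exact Ideal.Quotient.eq_zero_iff_mem.mpr (Ideal.subset_span (Or.inl rfl))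
  simp only [map_sub, map_mul, map_pow] at hrel
  linear_combination -hrel

end Summit.ResolutionOfSingularities.ResolutionOfSingularities.Theorems.FInjectiveMacaulayfication.TauFloorOneCIChartCore

end
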